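import Summits.ValiantsHypothesis.ValiantsHypothesis.Theorems.FifoMatchingNNDivisionHardFaceBlindCliqueZone
import Literature.Barriers.PneNP.LocalityAsymptotics

/-!
# FACE-BLIND / GENERATOR form of the located read on the zonotope chapter of COR-VIRTUAL (crux `NNDivisionHard`, stmt-ValiantsHypothesis-21181) — part 5/5 — §14: ★★★ THE COUNT DISCHARGED — `CovZonoHard` for clique-zone families in its literal `∀ C, ∃ h₀, ∀ h ≥ h₀, …` shape

Theorems-side port (val-port-1 g3, presser; desk RULING #357 (A); declaration texts VERBATIM) of val-idea-41 g3's crux workfile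
`Cruxes/NNDivisionHard/FaceBlind.lean` REV 7 @025cc0a9aa76 (sha16 588eb2e00eeb6290, 1599 l.; critic of record val-idea-crit-9 g2 VERDICT #43:
VERIFIED, KEEP §G(4)+(3), axioms standard), split by the 400-line cap into five chained modules `…FaceBlind` (§1–§10: typed statements,
`captureIffRefines`, `classZReduction`, `zonoEnemy_covers`) → `…FaceBlindRung` (§11: `zonoGenBlindAtDecided_holds`) → `…FaceBlindFewZones`
(§12: `fewZonesLaw_oneBlock`) → `…FaceBlindCliqueZone` (§13: `covZonoHard_cliqueZone`) → `…FaceBlindCount` (§14: `covZonoHardClique_holds`).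
DEDUP (desk: import, do not copy): the workfile's verbatim pastes of landed declarations are REPLACED by imports — `Jdir` :=
`ExposedFibre.Jdir` (✓ `…ExposedFibreRung`), `exists_large_avoid` / `exists_generic_comb` := `LowDim.*` (✓ `…LowDimFace`), `chi` / `uVec` / `uPush` /
`sum_uVec_chi` / `negRankOne_dot_corVec` / `sum_uPush_chi` := `ConePricing.*` (✓ `…ConePricing`); the pasted one-cut-rung lemmas of val-idea-40
(`admissible_blockDir`, `Admissible.dot_eq_zero_iff/dot_le/face_eq`, `exposedFibreRung_holds`, `exposedFibreDecided_holds`) keep their FOLDED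
statements here and are PROVED BY CITATION of the δ-unfolded landed theorems `ExposedFibre.*` (✓ p674xxx `…ExposedFibreRung`, val-port-4 g3 /
val-idea-40 g4).  Namespace `…Theorems.FifoMatching.FaceBlind` (workfile: `…Cruxes.NNDivisionHard.FaceBlind41`).

* `sum_choose_le`, `descFactorial_shift_le`, `choose_mul_pow_le_add_pow`, `pow_le_pow_mul_choose`, `count_of_numeric`, `numeric_core`, `count_holds`
  (the count at `m = d+1` blocks of size `t = ⌊h/m⌋` once `(2m)^6 ≤ h`), `natLog_two_le_two_mul_log`, `eventually_threshold` (`(log x)^n = o(x)`),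
  `covZonoHard_cliqueZone_eventually`, `cliqueZone_decided_eventually`, `CovZonoHardClique`, ★★★ `covZonoHardClique_holds`.

HONEST LABEL: helper rows for an OPEN crux (21181 `NNDivisionHard` OPEN; `CovZonoHard` OPEN for general zonotopal passengers); nothing here is a
summit statement; VP ≠ VNP is NOT proved.
-/

set_option autoImplicit false
set_option linter.dupNamespace false

noncomputable section
open Matrix Finset
open scoped Pointwise

namespace Summit.ValiantsHypothesis.ValiantsHypothesis.Theorems.FifoMatching.FaceBlind

open Literature.Barriers.PneNP (HasEFOfSize)
open Literature.Combinatorics.Optimization (corPolytopeGraph corVec)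
open Summit.ValiantsHypothesis.ValiantsHypothesis.Theorems.FifoMatching.ExposedFibre (Jdir)

variable {n m : ℕ}

/-! ## 14. ★★★ THE COUNT DISCHARGED — `CovZonoHard` for clique-zone families in its LITERAL shape `∀ C, ∃ h₀, ∀ h ≥ h₀, …`

The elementary count `(Σ_{j≤d} C(h,j))·C(h-t-1,t-1) < C(h-1,t-1)` of §13 holds at `m = d+1` blocks of size `t = ⌊h/m⌋` as soon
as `(2m)^6 ≤ h` (`count_holds`: shifted descending factorials `(h+t)^{t-1}(h-t-1)^{(t-1)↓} ≤ h^{t-1}(h-1)^{(t-1)↓}`, one binomial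
term `C(t-1,k)h^{t-1-k}t^k ≤ (h+t)^{t-1}` at `k = 2m`, `(n/k)^k ≤ C(n,k)`, and `m(2m)^{6m} < h^{m+1}`), and the polylog threshold
`(2m)^6 = (4(log₂h+C)^C+8)^6 ≤ h` is met for all large `h` (`eventually_threshold`, via `(log x)^n = o(x)`).  Hence
`covZonoHard_cliqueZone_eventually` and `cliqueZone_decided_eventually` — no side conditions left. -/

section Asymptotics
open Literature.Barriers.PneNP.Locality (natLog_two_le_two_mul_log)
-- `natLog_two_le_two_mul_log` is the LANDED `Literature.Barriers.PneNP.Locality.natLog_two_le_two_mul_log` (same text; dedup) — reused by name.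

/-- `Σ_{j ≤ d} C(h,j) ≤ (d+1)·h^d` for `h ≥ 1`. -/
theorem sum_choose_le (h d : ℕ) (hh : 1 ≤ h) : ∑ j ∈ Finset.Iic d, h.choose j ≤ (d + 1) * h ^ d := by
  calc ∑ j ∈ Finset.Iic d, h.choose j ≤ ∑ j ∈ Finset.Iic d, h ^ d :=
        Finset.sum_le_sum fun j hj => (Nat.choose_le_pow h j).trans
          (Nat.pow_le_pow_right hh (Finset.mem_Iic.1 hj))
    _ = (d + 1) * h ^ d := by rw [Finset.sum_const, Nat.card_Iic, smul_eq_mul]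

/-- the shifted descending-factorial comparison `(h+t)^{t-1}·(h-t-1)^{(t-1)↓} ≤ h^{t-1}·(h-1)^{(t-1)↓}`. -/
theorem descFactorial_shift_le (h t : ℕ) :
    (h + t) ^ (t - 1) * (h - t - 1).descFactorial (t - 1) ≤ h ^ (t - 1) * (h - 1).descFactorial (t - 1) := by
  rw [Nat.descFactorial_eq_prod_range, Nat.descFactorial_eq_prod_range, ← Finset.card_range (t - 1),
    ← Finset.prod_const, ← Finset.prod_const, Finset.card_range, ← Finset.prod_mul_distrib,
    ← Finset.prod_mul_distrib]
  refine Finset.prod_le_prod (fun i _ => Nat.zero_le _) fun i hi => ?_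
  have hi' := Finset.mem_range.1 hi
  rcases Nat.eq_zero_or_pos (h - t - 1 - i) with h0 | hpos
  · rw [h0]; simp
  · obtain ⟨x, hx⟩ : ∃ x, h = x + t + 1 + i + 1 := ⟨h - t - 1 - i - 1, by omega⟩
    have e1 : h - t - 1 - i = x + 1 := by omega
    have e2 : h - 1 - i = x + 1 + t := by omega
    rw [e1, e2, hx]
    nlinarith

/-- one binomial term: `C(n,k)·h^{n-k}·t^k ≤ (h+t)^n`. -/
theorem choose_mul_pow_le_add_pow (h t n k : ℕ) (hk : k ≤ n) :
    n.choose k * h ^ (n - k) * t ^ k ≤ (h + t) ^ n := by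
  rw [add_comm, add_pow]
  have := Finset.single_le_sum (f := fun m => t ^ m * h ^ (n - m) * n.choose m) (fun _ _ => Nat.zero_le _)
    (Finset.mem_range.2 (Nat.lt_succ_of_le hk))
  calc n.choose k * h ^ (n - k) * t ^ k = t ^ k * h ^ (n - k) * n.choose k := by ring
    _ ≤ _ := this

/-- `n^k ≤ k^k·C(n,k)` for `k ≤ n` (the bound `(n/k)^k ≤ C(n,k)`). -/
theorem pow_le_pow_mul_choose (n k : ℕ) (hk : k ≤ n) : n ^ k ≤ k ^ k * n.choose k := by
  have key : n ^ k * k.factorial ≤ k ^ k * n.descFactorial k := by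
    rw [← Nat.descFactorial_self, Nat.descFactorial_eq_prod_range, Nat.descFactorial_eq_prod_range,
      ← Finset.card_range k, ← Finset.prod_const, ← Finset.prod_const, Finset.card_range,
      ← Finset.prod_mul_distrib, ← Finset.prod_mul_distrib]
    refine Finset.prod_le_prod (fun i _ => Nat.zero_le _) fun i hi => ?_
    have hi' := Finset.mem_range.1 hi
    obtain ⟨a, ha⟩ : ∃ a, n = i + a := ⟨n - i, by omega⟩
    obtain ⟨b, hb⟩ : ∃ b, k = i + b := ⟨k - i, by omega⟩
    have hab : b ≤ a := by omega
    rw [ha, hb, Nat.add_sub_cancel_left, Nat.add_sub_cancel_left]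
    nlinarith [Nat.mul_le_mul_left i hab]
  rw [Nat.descFactorial_eq_factorial_mul_choose] at key
  have hf : 0 < k.factorial := Nat.factorial_pos k
  have : k.factorial * n ^ k ≤ k.factorial * (k ^ k * n.choose k) := by
    calc k.factorial * n ^ k = n ^ k * k.factorial := by ring
      _ ≤ k ^ k * (k.factorial * n.choose k) := key
      _ = k.factorial * (k ^ k * n.choose k) := by ring
  exact Nat.le_of_mul_le_mul_left this hf

/-- assembly: a numeric inequality `S·h^k·k^k < (t-1)^k·t^k` (with `k+1 ≤ t ≤ h`) gives the one-block count
`S·C(h-t-1,t-1) < C(h-1,t-1)`. -/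
theorem count_of_numeric (S h t k : ℕ) (hkt : k + 1 ≤ t) (hth : t ≤ h)
    (hnum : S * h ^ k * k ^ k < (t - 1) ^ k * t ^ k) :
    S * (h - t - 1).choose (t - 1) < (h - 1).choose (t - 1) := by
  have hkk : 0 < k ^ k := by
    rcases Nat.eq_zero_or_pos k with rfl | hk
    · simp
    · exact pow_pos hk k
  have hpos : 0 < h := by omega
  -- `S·h^k < C(t-1,k)·t^k`
  have hX : S * h ^ k < (t - 1).choose k * t ^ k := by
    have h1 : (t - 1) ^ k * t ^ k ≤ k ^ k * (t - 1).choose k * t ^ k :=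
      Nat.mul_le_mul_right _ (pow_le_pow_mul_choose (t - 1) k (by omega))
    have h2 : k ^ k * (S * h ^ k) < k ^ k * ((t - 1).choose k * t ^ k) := by
      calc k ^ k * (S * h ^ k) = S * h ^ k * k ^ k := by ring
        _ < (t - 1) ^ k * t ^ k := hnum
        _ ≤ k ^ k * (t - 1).choose k * t ^ k := h1
        _ = k ^ k * ((t - 1).choose k * t ^ k) := by ring
    exact Nat.lt_of_mul_lt_mul_left h2
  -- descending-factorial form
  suffices hD : S * (h - t - 1).descFactorial (t - 1) < (h - 1).descFactorial (t - 1) by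
    rw [Nat.descFactorial_eq_factorial_mul_choose, Nat.descFactorial_eq_factorial_mul_choose] at hD
    have : (t - 1).factorial * (S * (h - t - 1).choose (t - 1)) < (t - 1).factorial * (h - 1).choose (t - 1) := by
      calc (t - 1).factorial * (S * (h - t - 1).choose (t - 1))
          = S * ((t - 1).factorial * (h - t - 1).choose (t - 1)) := by ring
        _ < _ := hD
    exact Nat.lt_of_mul_lt_mul_left this
  rcases Nat.eq_zero_or_pos ((h - t - 1).descFactorial (t - 1)) with h0 | hDpos
  · rw [h0, mul_zero]
    exact Nat.pos_of_ne_zero fun h' => by rw [Nat.descFactorial_eq_zero_iff_lt] at h'; omega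
  · set D := (h - t - 1).descFactorial (t - 1)
    have hB := descFactorial_shift_le h t
    have hC := choose_mul_pow_le_add_pow h t (t - 1) k (by omega)
    have hpow : h ^ k * h ^ (t - 1 - k) = h ^ (t - 1) := by rw [← pow_add]; congr 1; omega
    have hhp : 0 < h ^ (t - 1 - k) := pow_pos hpos _
    have key : h ^ (t - 1) * (S * D) < h ^ (t - 1) * (h - 1).descFactorial (t - 1) := by
      calc h ^ (t - 1) * (S * D) = (S * h ^ k) * D * h ^ (t - 1 - k) := by rw [← hpow]; ring
        _ < ((t - 1).choose k * t ^ k) * D * h ^ (t - 1 - k) :=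
            mul_lt_mul_of_pos_right (mul_lt_mul_of_pos_right hX hDpos) hhp
        _ = ((t - 1).choose k * h ^ (t - 1 - k) * t ^ k) * D := by ring
        _ ≤ (h + t) ^ (t - 1) * D := Nat.mul_le_mul_right _ hC
        _ ≤ h ^ (t - 1) * (h - 1).descFactorial (t - 1) := hB
    exact Nat.lt_of_mul_lt_mul_left key

/-- arithmetic helper for `numeric_core` (first power estimate). -/
theorem pow_helper1 (x s k : ℕ) : (x * s) ^ k * (x * (s + 1)) ^ k = s ^ k * (s + 1) ^ k * x ^ (2 * k) := by
  rw [mul_pow, mul_pow, two_mul, pow_add]; ring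

/-- arithmetic helper for `numeric_core` (second power estimate). -/
theorem pow_helper2 (a h x d : ℕ) :
    (a * h ^ d) * h ^ (2 * (d + 1)) * x ^ (2 * (d + 1)) * x ^ (2 * (2 * (d + 1)))
      = (a * x ^ (6 * (d + 1))) * h ^ (d + 2 * (d + 1)) := by
  ring

/-- the numeric core at block count `m = d+1`, block size `t = s+1 = ⌊h/m⌋`, VC level `d`, binomial index `k = 2m`:
`(2m)^6 ≤ h` suffices. -/
theorem numeric_core (d h s : ℕ) (hbig : (2 * (d + 1)) ^ 6 ≤ h) (hhi : h < (d + 1) * (s + 1) + (d + 1)) :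
    ((d + 1) * h ^ d) * h ^ (2 * (d + 1)) * (2 * (d + 1)) ^ (2 * (d + 1))
      < s ^ (2 * (d + 1)) * (s + 1) ^ (2 * (d + 1)) := by
  have hxpos : 0 < 2 * (d + 1) := by omega
  have hx6 : 0 < (2 * (d + 1)) ^ 6 := pow_pos hxpos 6
  have hpos : 0 < h := by omega
  have h4 : 4 * (d + 1) ≤ h := by
    have : 4 * (d + 1) ≤ (2 * (d + 1)) ^ 6 := by
      calc 4 * (d + 1) ≤ (2 * (d + 1)) * (2 * (d + 1)) := by nlinarith
        _ = (2 * (d + 1)) ^ 2 := by ring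
        _ ≤ (2 * (d + 1)) ^ 6 := Nat.pow_le_pow_right hxpos (by norm_num)
    omega
  have hA : h ≤ 2 * (d + 1) * s := by
    have e : (d + 1) * (s + 1) + (d + 1) = (d + 1) * s + 2 * (d + 1) := by ring
    rw [e] at hhi
    have e2 : 2 * (d + 1) * s = 2 * ((d + 1) * s) := by ring
    rw [e2]
    generalize (d + 1) * s = X at hhi ⊢
    omega
  have hB : h ≤ 2 * (d + 1) * (s + 1) := by nlinarith
  have hAk := Nat.pow_le_pow_left hA (2 * (d + 1))
  have hBk := Nat.pow_le_pow_left hB (2 * (d + 1))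
  have H2 : h ^ (2 * (2 * (d + 1)))
      ≤ s ^ (2 * (d + 1)) * (s + 1) ^ (2 * (d + 1)) * (2 * (d + 1)) ^ (2 * (2 * (d + 1))) := by
    calc h ^ (2 * (2 * (d + 1))) = h ^ (2 * (d + 1)) * h ^ (2 * (d + 1)) := by rw [two_mul (2 * (d + 1)), pow_add]
      _ ≤ (2 * (d + 1) * s) ^ (2 * (d + 1)) * (2 * (d + 1) * (s + 1)) ^ (2 * (d + 1)) := Nat.mul_le_mul hAk hBk
      _ = _ := pow_helper1 (2 * (d + 1)) s (2 * (d + 1))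
  -- `m·(2m)^{6m} < h^{m+1}`
  have hsmall : (d + 1) * (2 * (d + 1)) ^ (6 * (d + 1)) < h ^ (d + 1 + 1) := by
    have h6 : (2 * (d + 1)) ^ (6 * (d + 1 + 1)) ≤ h ^ (d + 1 + 1) := by
      rw [pow_mul]; exact Nat.pow_le_pow_left hbig _
    have hmlt : d + 1 < (2 * (d + 1)) ^ 6 := by
      have := Nat.le_self_pow (n := 6) (by norm_num) (2 * (d + 1))
      omega
    calc (d + 1) * (2 * (d + 1)) ^ (6 * (d + 1)) < (2 * (d + 1)) ^ 6 * (2 * (d + 1)) ^ (6 * (d + 1)) :=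
          mul_lt_mul_of_pos_right hmlt (pow_pos hxpos _)
      _ = (2 * (d + 1)) ^ (6 * (d + 1 + 1)) := by rw [← pow_add]; congr 1; ring
      _ ≤ h ^ (d + 1 + 1) := h6
  have H1 : ((d + 1) * h ^ d) * h ^ (2 * (d + 1)) * (2 * (d + 1)) ^ (2 * (d + 1)) * (2 * (d + 1)) ^ (2 * (2 * (d + 1)))
      < h ^ (2 * (2 * (d + 1))) := by
    have e2 : h ^ (2 * (2 * (d + 1))) = h ^ (d + 1 + 1) * h ^ (d + 2 * (d + 1)) := by
      rw [← pow_add]; congr 1; ring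
    rw [pow_helper2, e2]
    exact mul_lt_mul_of_pos_right hsmall (pow_pos hpos _)
  exact Nat.lt_of_mul_lt_mul_right (lt_of_lt_of_le H1 H2)

/-- ★ THE ONE-BLOCK COUNT HOLDS at `m = d+1` blocks of size `t = ⌊h/m⌋` as soon as `(2m)^6 ≤ h`. -/
theorem count_holds (m d h t : ℕ) (hmd : m = d + 1) (hbig : (2 * m) ^ 6 ≤ h) (hlo : m * t ≤ h) (hhi : h < m * t + m) :
    (∑ j ∈ Finset.Iic d, h.choose j) * (h - t - 1).choose (t - 1) < (h - 1).choose (t - 1) := by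
  subst hmd
  have hpos : 0 < h := by
    have : 0 < (2 * (d + 1)) ^ 6 := pow_pos (by omega) 6
    omega
  -- `t ≥ 2m + 1`
  have ht : 2 * (d + 1) + 1 ≤ t := by
    by_contra hlt
    push Not at hlt
    have h1 : (d + 1) * t ≤ (d + 1) * (2 * (d + 1)) := Nat.mul_le_mul_left (d + 1) (by omega)
    have h2 : (d + 1) * (2 * (d + 1)) + (d + 1) ≤ (2 * (d + 1)) ^ 6 := by
      calc (d + 1) * (2 * (d + 1)) + (d + 1) ≤ (2 * (d + 1)) * (2 * (d + 1)) := by nlinarith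
        _ = (2 * (d + 1)) ^ 2 := by ring
        _ ≤ (2 * (d + 1)) ^ 6 := Nat.pow_le_pow_right (by omega) (by norm_num)
    generalize (d + 1) * t = P at *
    generalize (d + 1) * (2 * (d + 1)) = Q at *
    generalize (2 * (d + 1)) ^ 6 = R at *
    omega
  obtain ⟨s, rfl⟩ : ∃ s, t = s + 1 := ⟨t - 1, by omega⟩
  have hnum := numeric_core d h s hbig hhi
  have hS := sum_choose_le h d hpos
  refine count_of_numeric _ h (s + 1) (2 * (d + 1)) (by omega) (by nlinarith) ?_
  rw [Nat.add_sub_cancel]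
  calc (∑ j ∈ Finset.Iic d, h.choose j) * h ^ (2 * (d + 1)) * (2 * (d + 1)) ^ (2 * (d + 1))
      ≤ ((d + 1) * h ^ d) * h ^ (2 * (d + 1)) * (2 * (d + 1)) ^ (2 * (d + 1)) := by gcongr
    _ < s ^ (2 * (d + 1)) * (s + 1) ^ (2 * (d + 1)) := hnum

/-- ★ the polylog threshold is eventually met: `(2·(2(log₂ h + C)^C + 4))^6 ≤ h` for all large `h`. -/
theorem eventually_threshold (C : ℕ) : ∃ h₀ : ℕ, ∀ h ≥ h₀, (2 * (2 * (Nat.log 2 h + C) ^ C + 4)) ^ 6 ≤ h := by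
  have hK : (0 : ℝ) < (12 : ℝ) ^ 6 * ((C : ℝ) + 3) ^ (6 * C) := by positivity
  have hlo := (Real.isLittleO_pow_log_id_atTop (n := 6 * C)).def (show (0 : ℝ) < 1 / ((12 : ℝ) ^ 6 * ((C : ℝ) + 3) ^ (6 * C)) by positivity)
  have hnat := tendsto_natCast_atTop_atTop.eventually hlo
  obtain ⟨h₀, hh₀⟩ := Filter.eventually_atTop.1 (hnat.and (Filter.eventually_ge_atTop 3))
  refine ⟨h₀, fun h hh => ?_⟩
  obtain ⟨hℓ, hℓ3⟩ := hh₀ h hh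
  have hpos : (0 : ℝ) < h := by exact_mod_cast (show 0 < h by omega)
  rw [Real.norm_of_nonneg (by positivity), id, Real.norm_of_nonneg hpos.le] at hℓ
  have hlog1 : 1 ≤ Real.log h := by
    rw [← Real.log_exp 1]
    refine Real.log_le_log (Real.exp_pos 1) ?_
    have := Real.exp_one_lt_d9
    have h3 : (3 : ℝ) ≤ h := by exact_mod_cast hℓ3
    linarith
  have hN : (Nat.log 2 h : ℝ) ≤ 2 * Real.log h := natLog_two_le_two_mul_log (ℓ := h) (by omega)
  have hC0 : (0 : ℝ) ≤ C := Nat.cast_nonneg _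
  have hL0 : (0 : ℝ) ≤ Nat.log 2 h := Nat.cast_nonneg _
  have hA : (Nat.log 2 h : ℝ) + C + 1 ≤ ((C : ℝ) + 3) * Real.log h := by nlinarith
  have hB : (2 * (2 * ((Nat.log 2 h : ℝ) + C) ^ C + 4)) ≤ 12 * ((Nat.log 2 h : ℝ) + C + 1) ^ C := by
    have h1 : ((Nat.log 2 h : ℝ) + C) ^ C ≤ ((Nat.log 2 h : ℝ) + C + 1) ^ C :=
      pow_le_pow_left₀ (by positivity) (by linarith) C
    have h2 : (1 : ℝ) ≤ ((Nat.log 2 h : ℝ) + C + 1) ^ C := one_le_pow₀ (by linarith)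
    nlinarith
  have hC' : (12 * ((Nat.log 2 h : ℝ) + C + 1) ^ C) ^ 6
      ≤ (12 : ℝ) ^ 6 * ((C : ℝ) + 3) ^ (6 * C) * Real.log h ^ (6 * C) := by
    calc (12 * ((Nat.log 2 h : ℝ) + C + 1) ^ C) ^ 6 ≤ (12 * ((((C : ℝ) + 3) * Real.log h)) ^ C) ^ 6 := by
          gcongr
      _ = (12 : ℝ) ^ 6 * ((C : ℝ) + 3) ^ (6 * C) * Real.log h ^ (6 * C) := by
          rw [mul_pow, ← pow_mul, mul_pow]; ring
  have hD : (12 : ℝ) ^ 6 * ((C : ℝ) + 3) ^ (6 * C) * Real.log h ^ (6 * C) ≤ h := by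
    have := mul_le_mul_of_nonneg_left hℓ hK.le
    rwa [← mul_assoc, mul_one_div_cancel hK.ne', one_mul] at this
  have h0 : (0 : ℝ) ≤ 2 * (2 * ((Nat.log 2 h : ℝ) + C) ^ C + 4) := by positivity
  have : ((2 * (2 * (Nat.log 2 h + C) ^ C + 4) : ℕ) : ℝ) ^ 6 ≤ h := by
    push_cast
    exact ((pow_le_pow_left₀ h0 hB 6).trans hC').trans hD
  exact_mod_cast this

/-- ★★★ `CovZonoHard` FOR CLIQUE-ZONE FAMILIES, LITERAL SHAPE (no side conditions): for every `C` and all large `h`, a clique-zone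
family with distinct patterns and positive lengths whose zones COVER level `2(log₂h+C)^C + 4` has
`xc(w + Σ_i [0,1]·λ_i 𝟙_{S_i}𝟙_{S_i}ᵀ) > 2^{(log₂h+C)^C}` — on the passenger's own budget. -/
theorem covZonoHard_cliqueZone_eventually (C : ℕ) : ∃ h₀ : ℕ, ∀ h ≥ h₀,
    ∀ (M : ℕ) (pat : Fin M → (Fin h → Bool)) (lam : Fin M → ℝ) (w : Fin h × Fin h → ℝ) (r : ℕ),
      Function.Injective pat → (∀ i, 0 < lam i) →
      Covers h (2 * (Nat.log 2 h + C) ^ C + 4) (fun i => cliqueZone (lam i) (pat i)) →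
      HasEFOfSize (convexHull ℝ (Set.range (subsetSum (fun i => cliqueZone (lam i) (pat i)) w))) r →
        2 ^ ((Nat.log 2 h + C) ^ C) < r := by
  obtain ⟨h₀, hh₀⟩ := eventually_threshold C
  refine ⟨h₀, fun h hh M pat lam w r hinj hlam hcov hEF => ?_⟩
  have hbig := hh₀ h hh
  set L := (Nat.log 2 h + C) ^ C with hLdef
  set m := 2 * L + 4 with hmdef
  have hm : 0 < m := by omega
  have hmh : m ≤ h := by
    have := Nat.le_self_pow (n := 6) (by norm_num) (2 * m)
    omega
  have hlo : m * (h / m) ≤ h := Nat.mul_div_le h m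
  have hhi : h < m * (h / m) + m := by
    have := Nat.lt_div_mul_add (a := h) hm
    rwa [mul_comm] at this
  have ht : 1 ≤ h / m := Nat.div_pos hmh hm
  have hcount := count_holds m (2 * L + 3) h (h / m) (by omega) hbig hlo hhi
  exact covZonoHard_cliqueZone C h (h / m) M pat lam w r ht hlo hinj hlam hcount hcov hEF

/-- ★★★ THE CLIQUE-ZONE CHAPTER OF COR-MINKOWSKI, LITERAL SHAPE: for every `C` and all large `h`, a clique-zone passenger `Z`
(distinct patterns, positive lengths, any translation) with `xc(Z) ≤ r` and `xc(COR(K_h) + Z) ≤ r` has `2^{(log₂h+C)^C} < r`. -/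
theorem cliqueZone_decided_eventually (C : ℕ) : ∃ h₀ : ℕ, ∀ h ≥ h₀,
    ∀ (M : ℕ) (pat : Fin M → (Fin h → Bool)) (lam : Fin M → ℝ) (w : Fin h × Fin h → ℝ) (r : ℕ),
      Function.Injective pat → (∀ i, 0 < lam i) →
      HasEFOfSize (convexHull ℝ (Set.range (subsetSum (fun i => cliqueZone (lam i) (pat i)) w))) r →
      HasEFOfSize (corPolytopeGraph (⊤ : SimpleGraph (Fin h)) +
        convexHull ℝ (Set.range (subsetSum (fun i => cliqueZone (lam i) (pat i)) w))) r →
        2 ^ ((Nat.log 2 h + C) ^ C) < r := by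
  obtain ⟨h₀, hh₀⟩ := eventually_threshold C
  refine ⟨h₀, fun h hh M pat lam w r hinj hlam hEF₁ hEF₂ => ?_⟩
  have hbig := hh₀ h hh
  set L := (Nat.log 2 h + C) ^ C with hLdef
  set m := 2 * L + 4 with hmdef
  have hm : 0 < m := by omega
  have hmh : m ≤ h := by
    have := Nat.le_self_pow (n := 6) (by norm_num) (2 * m)
    omega
  have hlo : m * (h / m) ≤ h := Nat.mul_div_le h m
  have hhi : h < m * (h / m) + m := by
    have := Nat.lt_div_mul_add (a := h) hm
    rwa [mul_comm] at this
  have ht : 1 ≤ h / m := Nat.div_pos hmh hm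
  have hcount := count_holds m (2 * L + 3) h (h / m) (by omega) hbig hlo hhi
  exact cliqueZone_decided C h (h / m) M pat lam w r ht hlo hinj hlam hcount hEF₁ hEF₂

/-- ★★★ TYPED FOR CITATION: `CovZonoHard` (§8) RESTRICTED TO CLIQUE-ZONE FAMILIES — `gen i = λ_i • corVec ⊤ (S_i)` with distinct
patterns and positive lengths (wlog for such families: equal patterns merge, zero lengths drop). -/
def CovZonoHardClique : Prop :=
  ∀ C : ℕ, ∃ h₀ : ℕ, ∀ h ≥ h₀,
    ∀ (M : ℕ) (pat : Fin M → (Fin h → Bool)) (lam : Fin M → ℝ) (w : Fin h × Fin h → ℝ) (r : ℕ),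
      Function.Injective pat → (∀ i, 0 < lam i) →
      Covers h (2 * (Nat.log 2 h + C) ^ C + 4) (fun i => cliqueZone (lam i) (pat i)) →
      HasEFOfSize (convexHull ℝ (Set.range (subsetSum (fun i => cliqueZone (lam i) (pat i)) w))) r →
        2 ^ ((Nat.log 2 h + C) ^ C) < r

/-- ★★★ PROVED. -/
theorem covZonoHardClique_holds : CovZonoHardClique := covZonoHard_cliqueZone_eventually

end Asymptotics

end Summit.ValiantsHypothesis.ValiantsHypothesis.Theorems.FifoMatching.FaceBlind

end
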